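import Summits.NavierStokesRegularity.FunctionalMining.TopEigAmplitudeFloorHolds
import Summits.NavierStokesRegularity.FunctionalMining.NoGo.TopEigSaturatingKill
import HarnessLib

/-!
# FunctionalMining / NoGo — K62: the DISCRETE FRAME FLOOR of the `Φ_q` heat price
# (door (e), DOOR-E-SPEC § 4: the FRAME COST typed and kernel-checked WITHOUT eigenvectors)

HONEST FRAMING. Search for candidate a priori estimates; no regularity claim. Nothing about Navier–Stokes is
proved or asserted in this file. Cell `pub-nsfunc`, no-go seat (gen 54, touch 2). Static calculus of smooth fields
on the flat torus `T^d` (every finite non-empty index type `d`).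

CONTEXT. Door (b)/(F2) of `NOGO.md` = the WANTED kernel negation `¬ TopEigHeatCoercivePos q` of the open node
Lemma L-λ(q) (`TopEigHeatCoercive.lean`, OPEN in the kernel ∀ real `q > 1`); door (e) = the kernel construction of a
killing family. The treeʼs AMPLITUDE FLOOR (LEMMA AF, `topEigAmplitudeFloor_of_two_le`: `q(q−1)∫λ^{q−2}Σᵢ(∂ᵢλ)² ≤
heatDissipation Φ_q v`, `λ := λ₁ ∘ S_v`) prices the AMPLITUDE of `λ₁` only; the pen identity behind the killing-shape
rulings also has a FRAME part `∫ qλ^{q−1}·2ΣₖΣ_{a≠1}(λ₁−λ_a)|u_a·∂ₖu₁|²` (rotation of the top frame is priced), listed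
in `DOOR-E-SPEC` § 4 as NOT PROVED in the kernel: its integrand needs an eigenframe, undefined across crossings.
THE OBSERVATION. The frame part has an EIGENVECTOR-FREE discrete avatar. With the axis steps `x ± teᵢ`,
`M_t(x) := Σᵢ (S(x+teᵢ) + S(x−teᵢ) − 2S(x))` and the treeʼs `μ(A; M) = max {eᵀMe : e a top unit vector of A}`
(`TopEig.dirTopEig`), put `FD_t(x) := Σᵢ (λ(x+teᵢ) + λ(x−teᵢ) − 2λ(x)) − μ(S(x); M_t(x))` (the FRAME DEFECT). Then:
(§ 1) `FD_t(x) = min over top unit vectors e of S(x) of Σᵢ,± (λ₁ − eᵀSe)(x ± teᵢ) ≥ 0` — the least total RAYLEIGH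
DEFECT of a frozen top vector at the `2d` grid neighbours (pure algebra + the attained Danskin max); (§ 2)
`|μ(S; M_t) − t² μ(S; S_(Δv))| ≤ C|t|³` (Taylor, `ΔS_v = S_(Δv)`; tree); (§ 4) THE DISCRETE FRAME IDENTITY, every real
`q ≥ 1`, every `t > 0`: `|A_t + t⁻² ∫ qλ^{q−1} FD_t − heatDissipation Φ_q v| ≤ C·t`, where `A_t := Σᵢ ∫ [(φ(x+teᵢ) −
φ(x))/t]·[(λ(x+teᵢ) − λ(x))/t]`, `φ := qλ^{q−1}`, is the treeʼs discrete amplitude form (discrete integration by parts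
+ the Danskin formula, the treeʼs architecture) — the treeʼs one-sided discrete floor `A_t ≤ heat + Ct` gains the
non-negative frame term AND becomes TWO-SIDED (an eigenvector-free upper bound on the heat price by grid quantities);
(§ 5) for real `q ≥ 2` (the treeʼs dominated limit `A_t → AF(v)`): `t⁻² ∫ φ FD_t → heatDissipation Φ_q v − AF(v) =:
frameCost q v ≥ 0` as `t → 0⁺` — the FRAME COST is a LIMIT OF EXPLICIT NON-NEGATIVE GRID QUANTITIES built from `λ₁`
and `S` alone (no frame, no crossing analysis), in every dimension; (§ 6) KILL RULE (bookkeeping for door (e)):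
`heat ≤ c·Φ_q` forces BOTH `AF ≤ c·Φ_q` AND `frameCost ≤ c·Φ_q` — a killing family must make the amplitude floor AND
the frame cost `o(Φ_q)` SEPARATELY (the healed chevron keeps `u₁` constant on its wells; a family lowering amplitude
variation by ROTATING the top frame pays in `frameCost`).
NOT here: the smooth identification `lim t⁻²FD_t = 2ΣₖΣ_{a≠1}(λ₁−λ_a)|u_a·∂ₖu₁|²` on `{λ₂ < λ₁}` (pen only); the `liminf`
form for `1 < q < 2`; any verdict change (L-λ(q) OPEN in the kernel ∀ real q > 1; door (b) on paper: RULING (ζζ)); no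
𝒦₀ row, no A12 count, no T_LD. [ours = §§ 1, 2, 4–6; folklore = § 3 (measurability via Danskin quotients)]
FILING (prove seat g30, REQUEST #91): declarations byte-identical to the no-go seat's staged `TopEigHeatFrameFloor.STAGING.lean` 59ae71c942c18771; this line is the only addition.
-/

noncomputable section

open MeasureTheory Set Filter Topology

namespace Summit.NavierStokesRegularity.FunctionalMining

open Literature.Analysis.FunctionSpaces Literature.Analysis.FluidPDE

variable {d : Type*} [Fintype d] [DecidableEq d]

namespace TopEig

namespace FrameFloor

open StrainL4

/-! ## § 1 Second differences, the Rayleigh defect, the frame defect -/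

/-- `M_t(x) := Σᵢ (S(x+teᵢ) + S(x−teᵢ) − 2S(x))`, the summed axis second differences of the strain. [ours,
bookkeeping] -/
def strainSecondDiff (v : UnitAddTorus d → EuclideanSpace ℝ d) (t : ℝ) (x : UnitAddTorus d) :
    EuclideanSpace ℝ (d × d) :=
  ∑ i, (strainFlat v (x + Torus.proj (t • EuclideanSpace.single i (1 : ℝ))) +
      strainFlat v (x + Torus.proj ((-t) • EuclideanSpace.single i (1 : ℝ))) - (2 : ℝ) • strainFlat v x)

/-- `Σᵢ (λ(x+teᵢ) + λ(x−teᵢ) − 2λ(x))`, `λ := λ₁ ∘ S_v`, the summed axis second differences of the top strain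
eigenvalue. [ours, bookkeeping] -/
def topEigSecondDiff (v : UnitAddTorus d → EuclideanSpace ℝ d) (t : ℝ) (x : UnitAddTorus d) : ℝ :=
  ∑ i, (torusStrainTopEig v (x + Torus.proj (t • EuclideanSpace.single i (1 : ℝ))) +
      torusStrainTopEig v (x + Torus.proj ((-t) • EuclideanSpace.single i (1 : ℝ))) - 2 * torusStrainTopEig v x)

/-- The RAYLEIGH DEFECT of a vector `e` at `y`: `λ₁(S(y)) − eᵀS(y)e` (`≥ 0` for unit `e`; `= 0` iff `e` is a top unit
vector of `S(y)`). [ours, bookkeeping] -/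
def rayleighDefect (v : UnitAddTorus d → EuclideanSpace ℝ d) (e : d → ℝ) (y : UnitAddTorus d) : ℝ :=
  torusStrainTopEig v y - quad (strainFlat v y) e

variable [Nonempty d]

/-- The FRAME DEFECT at step `t`: `FD_t(x) := Σᵢ (λ(x+teᵢ) + λ(x−teᵢ) − 2λ(x)) − μ(S(x); M_t(x))` — by how much the
second differences of `λ₁` exceed the directional derivative of `λ₁` at `S(x)` along the second differences of `S`.
Eigenvector-free. [ours] -/
def frameDefect (v : UnitAddTorus d → EuclideanSpace ℝ d) (t : ℝ) (x : UnitAddTorus d) : ℝ :=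
  topEigSecondDiff v t x - dirTopEig (strainFlat v x) (strainSecondDiff v t x)

variable {v : UnitAddTorus d → EuclideanSpace ℝ d} {q : ℝ}

omit [DecidableEq d] [Nonempty d] in
/-- `quad` of a finite sum of tensors (local copy of the treeʼs bookkeeping lemma). [folklore] -/
private theorem quad_finset_sum_ff {ι : Type*} (s : Finset ι) (N : ι → EuclideanSpace ℝ (d × d)) (e : d → ℝ) :
    quad (∑ k ∈ s, N k) e = ∑ k ∈ s, quad (N k) e := by
  classical
  refine Finset.induction_on s ?_ ?_
  · simp [quad]
  · intro k s hk ih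
    rw [Finset.sum_insert hk, Finset.sum_insert hk, quad_add, ih]

/-- The Rayleigh defect of a unit vector is non-negative. [folklore] -/
theorem rayleighDefect_nonneg (v : UnitAddTorus d → EuclideanSpace ℝ d) {e : d → ℝ} (he : e ∈ unitSphere d)
    (y : UnitAddTorus d) : 0 ≤ rayleighDefect v e y := by
  unfold rayleighDefect
  rw [← lam_strainFlat]
  exact sub_nonneg.2 (quad_le_lam _ he)

/-- **The frame identity (pure algebra).** For a top unit vector `e` of `S(x)`, the second differences of `λ₁` equal
`eᵀM_t(x)e` plus the Rayleigh defects of `e` at the `2d` grid neighbours (for a general `e`, minus `2d` times its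
defect at the centre). [ours] -/
theorem topEigSecondDiff_eq_of_mem (v : UnitAddTorus d → EuclideanSpace ℝ d) (t : ℝ) {x : UnitAddTorus d}
    {e : d → ℝ} (he : e ∈ topEigSet (strainFlat v x)) : topEigSecondDiff v t x =
      quad (strainSecondDiff v t x) e + ∑ i, (rayleighDefect v e (x + Torus.proj (t • EuclideanSpace.single i (1 : ℝ))) +
          rayleighDefect v e (x + Torus.proj ((-t) • EuclideanSpace.single i (1 : ℝ)))) := by
  unfold topEigSecondDiff strainSecondDiff rayleighDefect
  rw [quad_finset_sum_ff, ← Finset.sum_add_distrib]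
  refine Finset.sum_congr rfl fun i _ => ?_
  rw [quad_sub, quad_add, quad_smul, he.2, lam_strainFlat]
  ring

/-- The frame defect is at most the total neighbour defect of ANY top unit vector of `S(x)`. [ours] -/
theorem frameDefect_le_of_mem (v : UnitAddTorus d → EuclideanSpace ℝ d) (t : ℝ) {x : UnitAddTorus d} {e : d → ℝ}
    (he : e ∈ topEigSet (strainFlat v x)) :
    frameDefect v t x ≤ ∑ i, (rayleighDefect v e (x + Torus.proj (t • EuclideanSpace.single i (1 : ℝ))) +
        rayleighDefect v e (x + Torus.proj ((-t) • EuclideanSpace.single i (1 : ℝ)))) := by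
  unfold frameDefect
  rw [topEigSecondDiff_eq_of_mem v t he]
  linarith [quad_le_dirTopEig (strainSecondDiff v t x) he]

/-- **The frame defect is a minimum, attained:** `FD_t(x) = Σᵢ,± (λ₁ − eᵀSe)(x ± teᵢ)` for SOME top unit vector `e`
of `S(x)` (a Danskin maximiser). [ours] -/
theorem exists_frameDefect_eq (v : UnitAddTorus d → EuclideanSpace ℝ d) (t : ℝ) (x : UnitAddTorus d) :
    ∃ e ∈ topEigSet (strainFlat v x),
      frameDefect v t x = ∑ i, (rayleighDefect v e (x + Torus.proj (t • EuclideanSpace.single i (1 : ℝ))) +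
          rayleighDefect v e (x + Torus.proj ((-t) • EuclideanSpace.single i (1 : ℝ)))) := by
  obtain ⟨e, he, hq⟩ := exists_quad_eq_dirTopEig (strainFlat v x) (strainSecondDiff v t x)
  refine ⟨e, he, ?_⟩
  unfold frameDefect
  rw [topEigSecondDiff_eq_of_mem v t he, ← hq]
  ring

/-- **The frame defect is non-negative** (every field, every `t`, every `x`). [ours] -/
theorem frameDefect_nonneg (v : UnitAddTorus d → EuclideanSpace ℝ d) (t : ℝ) (x : UnitAddTorus d) :
    0 ≤ frameDefect v t x := by
  obtain ⟨e, he, h⟩ := exists_frameDefect_eq v t x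
  rw [h]
  exact Finset.sum_nonneg fun i _ => add_nonneg (rayleighDefect_nonneg v he.1 _) (rayleighDefect_nonneg v he.1 _)

/-! ## § 2 Taylor: `μ(S; M_t)` against `t² μ(S; S_(Δv))` -/

omit [Nonempty d] in
/-- `‖M_t(x) − t² S_(Δv)(x)‖ ≤ C|t|³` (fourth-order Taylor per axis and `ΔS_v = S_(Δv)`: the treeʼs §§ 1–2 of
`TopEigAmplitudeFloor`). [ours] -/
theorem exists_norm_strainSecondDiff_sub_le (hv : Torus.IsSmooth v) : ∃ C, ∀ (x : UnitAddTorus d) (t : ℝ),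
    ‖strainSecondDiff v t x - t ^ 2 • strainFlat (Torus.laplacian v) x‖ ≤ C * |t| ^ 3 := by
  have hS := isSmooth_strainFlat hv
  choose C hC using fun i : d => exists_norm_secondDiff_sub_le (strainFlat v) hS (EuclideanSpace.single i (1 : ℝ))
  refine ⟨∑ i, C i, fun x t => ?_⟩
  have hlap : ∑ i, Torus.lineDeriv (fun y => Torus.lineDeriv (strainFlat v) y (EuclideanSpace.single i (1 : ℝ))) x
      (EuclideanSpace.single i (1 : ℝ)) = strainFlat (Torus.laplacian v) x := by
    rw [← laplacian_strainFlat hv x, Torus.laplacian_eq_sum_partialDeriv_partialDeriv hS x]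
    rfl
  unfold strainSecondDiff
  rw [← hlap, Finset.smul_sum, ← Finset.sum_sub_distrib, Finset.sum_mul]
  exact (norm_sum_le _ _).trans (Finset.sum_le_sum fun i _ => hC i x t)

/-- **`|μ(S(x); M_t(x)) − t² μ(S(x); S_(Δv)(x))| ≤ C|t|³`** (`μ(A; ·)` is subadditive, `1`-Lipschitz and positively
homogeneous). [ours] -/
theorem exists_abs_dirTopEig_strainSecondDiff_sub_le (hv : Torus.IsSmooth v) : ∃ C, ∀ (x : UnitAddTorus d) (t : ℝ),
    |dirTopEig (strainFlat v x) (strainSecondDiff v t x) -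
      t ^ 2 * dirTopEig (strainFlat v x) (strainFlat (Torus.laplacian v) x)| ≤ C * |t| ^ 3 := by
  obtain ⟨C, hC⟩ := exists_norm_strainSecondDiff_sub_le hv
  refine ⟨C, fun x t => ?_⟩
  have key : ∀ M N : EuclideanSpace ℝ (d × d), dirTopEig (strainFlat v x) M ≤ dirTopEig (strainFlat v x) N + ‖M - N‖ :=
    fun M N => by
      have h := dirTopEig_add_le (strainFlat v x) N (M - N)
      rw [add_sub_cancel] at h
      linarith [dirTopEig_le_norm (strainFlat v x) (M - N)]
  have h1 := key (strainSecondDiff v t x) (t ^ 2 • strainFlat (Torus.laplacian v) x)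
  have h2 := key (t ^ 2 • strainFlat (Torus.laplacian v) x) (strainSecondDiff v t x)
  rw [norm_sub_rev] at h2
  rw [dirTopEig_smul_of_nonneg (sq_nonneg t)] at h1 h2
  rw [abs_le]
  constructor <;> linarith [hC x t]

/-! ## § 3 Continuity, measurability, integrability -/

/-- `φ · μ(A; M)` is integrable on the torus for continuous `φ`, `A`, `M` (`|μ(A; M)| ≤ ‖M‖`). [folklore] -/
theorem integrable_mul_dirTopEig {φ : UnitAddTorus d → ℝ} {A M : UnitAddTorus d → EuclideanSpace ℝ (d × d)}
    (hφ : Continuous φ) (hA : Continuous A) (hM : Continuous M) :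
    Integrable (fun x => φ x * dirTopEig (A x) (M x)) volume :=
  Integrable.mono' (hφ.norm.mul hM.norm).integrable_unitAddTorus
    (hφ.aestronglyMeasurable.mul (aestronglyMeasurable_dirTopEig_comp hA hM))
    (ae_of_all _ fun x => by
      rw [norm_mul]
      exact mul_le_mul_of_nonneg_left (by rw [Real.norm_eq_abs]; exact abs_dirTopEig_le_norm _ _) (norm_nonneg _))

omit [Nonempty d] in
/-- `x ↦ M_t(x)` is continuous. [folklore] -/
theorem continuous_strainSecondDiff (hv : Torus.IsSmooth v) (t : ℝ) : Continuous (strainSecondDiff v t) := by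
  have hc := continuous_strainFlat hv
  unfold strainSecondDiff
  exact continuous_finsetSum _ fun i _ => ((hc.comp (continuous_id.add continuous_const)).add
    (hc.comp (continuous_id.add continuous_const))).sub (hc.const_smul (2 : ℝ))

/-- `x ↦ Σᵢ (λ(x+teᵢ) + λ(x−teᵢ) − 2λ(x))` is continuous. [folklore] -/
theorem continuous_topEigSecondDiff (hv : Torus.IsSmooth v) (t : ℝ) : Continuous (topEigSecondDiff v t) := by
  have hc := continuous_torusStrainTopEig hv
  unfold topEigSecondDiff
  exact continuous_finsetSum _ fun i _ => ((hc.comp (continuous_id.add continuous_const)).add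
    (hc.comp (continuous_id.add continuous_const))).sub (continuous_const.mul hc)

/-- The weighted frame defect `qλ^{q−1} · FD_t` is integrable (`q ≥ 1`). [ours, bookkeeping] -/
theorem integrable_weight_mul_frameDefect (hq : 1 ≤ q) (hv : Torus.IsSmooth v) (t : ℝ) :
    Integrable (fun x => q * torusStrainTopEig v x ^ (q - 1) * frameDefect v t x) volume := by
  have hφc : Continuous fun x => q * torusStrainTopEig v x ^ (q - 1) :=
    continuous_const.mul ((continuous_torusStrainTopEig hv).rpow_const fun _ => Or.inr (by linarith))
  have h1 : Integrable (fun x => q * torusStrainTopEig v x ^ (q - 1) * topEigSecondDiff v t x) volume :=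
    (hφc.mul (continuous_topEigSecondDiff hv t)).integrable_unitAddTorus
  have h2 := integrable_mul_dirTopEig hφc (continuous_strainFlat hv) (continuous_strainSecondDiff hv t)
  simp only [frameDefect, mul_sub]
  exact h1.sub h2

/-! ## § 4 The discrete frame identity (every real `q ≥ 1`, every `t > 0`) -/

/-- The treeʼs discrete amplitude form `A_t := Σᵢ ∫ [(φ(x+teᵢ) − φ(x))/t]·[(λ(x+teᵢ) − λ(x))/t]`, `φ := qλ^{q−1}`.
[ours, bookkeeping] -/
def slopeIntegral (q : ℝ) (v : UnitAddTorus d → EuclideanSpace ℝ d) (t : ℝ) : ℝ :=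
  ∑ i, ∫ x, (q * torusStrainTopEig v (x + Torus.proj (t • EuclideanSpace.single i (1 : ℝ))) ^ (q - 1) - q * torusStrainTopEig v x ^ (q - 1)) / t *
    ((torusStrainTopEig v (x + Torus.proj (t • EuclideanSpace.single i (1 : ℝ))) - torusStrainTopEig v x) / t)

/-- The weighted frame integral `F_t := ∫ qλ^{q−1} FD_t`. [ours, bookkeeping] -/
def frameIntegral (q : ℝ) (v : UnitAddTorus d → EuclideanSpace ℝ d) (t : ℝ) : ℝ :=
  ∫ x, q * torusStrainTopEig v x ^ (q - 1) * frameDefect v t x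

/-- `F_t ≥ 0` for fields with `λ₁ ∘ S ≥ 0` (e.g. divergence-free ones) and `q ≥ 0`. [ours] -/
theorem frameIntegral_nonneg (hq : 0 ≤ q) (hv : Torus.IsSmooth v) (hdv : Torus.IsDivFree v) (t : ℝ) :
    0 ≤ frameIntegral q v t := by
  unfold frameIntegral
  refine integral_nonneg fun x => mul_nonneg (mul_nonneg hq (Real.rpow_nonneg ?_ _)) (frameDefect_nonneg v t x)
  rw [← lam_strainFlat]
  exact lam_strainFlat_nonneg hv hdv x

omit [Fintype d] [DecidableEq d] [Nonempty d] in
/-- `φ ≥ 0`, `|a − t²b| ≤ C|t|³`, `t > 0` ⟹ `‖φa − t²(φb)‖ ≤ Ct³φ`. [folklore, bookkeeping] -/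
private theorem weight_aux {φ a b t C : ℝ} (hφ : 0 ≤ φ) (ht : 0 < t) (h : |a - t ^ 2 * b| ≤ C * |t| ^ 3) :
    ‖φ * a - t ^ 2 * (φ * b)‖ ≤ C * t ^ 3 * φ := by
  rw [Real.norm_eq_abs, show φ * a - t ^ 2 * (φ * b) = φ * (a - t ^ 2 * b) by ring, abs_mul, abs_of_nonneg hφ]
  rw [abs_of_pos ht] at h
  nlinarith

/-- **THE DISCRETE FRAME IDENTITY.** For smooth divergence-free `v` on `T^d`, every real `q ≥ 1` and every `t > 0`:
`|A_t + t⁻² F_t − heatDissipation Φ_q v| ≤ C·t` with `C` independent of `t` (discrete integration by parts per axis,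
§ 2 integrated against `φ ≥ 0`, and the treeʼs Danskin formula `heatDissipation Φ_q v = −∫ φ μ(S; S_(Δv))`). [ours] -/
theorem exists_abs_slope_add_frame_sub_heat_le (hq : 1 ≤ q) (hv : Torus.IsSmooth v) (hdv : Torus.IsDivFree v) :
    ∃ C : ℝ, ∀ t : ℝ, 0 < t →
      |slopeIntegral q v t + frameIntegral q v t / t ^ 2 - heatDissipation (torusTopEigMoment q) v| ≤ C * t := by
  set L := torusStrainTopEig v with hL
  obtain ⟨C, hC⟩ := exists_abs_dirTopEig_strainSecondDiff_sub_le hv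
  have hLc : Continuous L := continuous_torusStrainTopEig hv
  have hLnn : ∀ y, 0 ≤ L y := fun y => by rw [hL, ← lam_strainFlat]; exact lam_strainFlat_nonneg hv hdv y
  have hφc : Continuous fun x => q * L x ^ (q - 1) := continuous_const.mul (hLc.rpow_const fun _ => Or.inr (by linarith))
  have hφnn : ∀ x, 0 ≤ q * L x ^ (q - 1) := fun x => mul_nonneg (by linarith) (Real.rpow_nonneg (hLnn x) _)
  have hφi : Integrable (fun x => q * L x ^ (q - 1)) volume := hφc.integrable_unitAddTorus
  refine ⟨C * ∫ x, q * L x ^ (q - 1), fun t ht => ?_⟩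
  have ht2 : 0 < t ^ 2 := by positivity
  have hXi : Integrable (fun x => q * L x ^ (q - 1) * dirTopEig (strainFlat v x) (strainSecondDiff v t x)) volume :=
    integrable_mul_dirTopEig hφc (continuous_strainFlat hv) (continuous_strainSecondDiff hv t)
  have hYi : Integrable (fun x => q * L x ^ (q - 1) * dirTopEig (strainFlat v x) (strainFlat (Torus.laplacian v) x))
      volume := integrable_danskinDensity hq hv hv.laplacian hdv
  have hFi := integrable_weight_mul_frameDefect hq hv t
  set X := ∫ x, q * L x ^ (q - 1) * dirTopEig (strainFlat v x) (strainSecondDiff v t x) with hX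
  set Y := ∫ x, q * L x ^ (q - 1) * dirTopEig (strainFlat v x) (strainFlat (Torus.laplacian v) x) with hY
  have hsplit : ∫ x, q * L x ^ (q - 1) * topEigSecondDiff v t x = X + frameIntegral q v t := by
    rw [hX, frameIntegral, ← integral_add hXi hFi]
    exact integral_congr_ae (ae_of_all _ fun x => by show _ = _; unfold frameDefect; ring)
  have hibp : ∫ x, q * L x ^ (q - 1) * topEigSecondDiff v t x = -(t ^ 2) * slopeIntegral q v t := by
    have hDc : ∀ i : d, Continuous fun x => L (x + Torus.proj (t • EuclideanSpace.single i (1 : ℝ))) +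
        L (x + Torus.proj ((-t) • EuclideanSpace.single i (1 : ℝ))) - 2 * L x := fun i =>
      ((hLc.comp (continuous_id.add continuous_const)).add (hLc.comp (continuous_id.add continuous_const))).sub
        (continuous_const.mul hLc)
    have e2 : (fun x => q * L x ^ (q - 1) * topEigSecondDiff v t x) =
        fun x => ∑ i, q * L x ^ (q - 1) * (L (x + Torus.proj (t • EuclideanSpace.single i (1 : ℝ))) +
            L (x + Torus.proj ((-t) • EuclideanSpace.single i (1 : ℝ))) - 2 * L x) := by
      funext x; unfold topEigSecondDiff; rw [Finset.mul_sum]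
    have hI3 : ∀ i, Integrable (fun x => q * L x ^ (q - 1) * (L (x + Torus.proj (t • EuclideanSpace.single i (1 : ℝ))) +
        L (x + Torus.proj ((-t) • EuclideanSpace.single i (1 : ℝ))) - 2 * L x)) volume :=
      fun i => (hφc.mul (hDc i)).integrable_unitAddTorus
    rw [e2, integral_finsetSum _ (fun i _ => hI3 i), slopeIntegral, Finset.mul_sum, ← hL]
    refine Finset.sum_congr rfl fun i _ => ?_
    have hax := integral_mul_secondDiff_eq hφc hLc (Torus.proj (t • EuclideanSpace.single i (1 : ℝ)))
    have e3 : (fun x => q * L x ^ (q - 1) * (L (x + Torus.proj (t • EuclideanSpace.single i (1 : ℝ))) +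
        L (x + Torus.proj ((-t) • EuclideanSpace.single i (1 : ℝ))) - 2 * L x)) =
        fun x => q * L x ^ (q - 1) * (L (x + Torus.proj (t • EuclideanSpace.single i (1 : ℝ))) +
            L (x - Torus.proj (t • EuclideanSpace.single i (1 : ℝ))) - 2 * L x) := by
      funext x; rw [neg_smul, Torus.proj_neg, ← sub_eq_add_neg]
    rw [e3, hax, neg_mul, ← integral_const_mul]
    congr 1
    refine integral_congr_ae (Filter.Eventually.of_forall fun x => ?_)
    show _ = t ^ 2 * _
    field_simp
  have hXY : |X - t ^ 2 * Y| ≤ C * t ^ 3 * ∫ x, q * L x ^ (q - 1) := by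
    rw [hX, hY, ← integral_const_mul, ← integral_sub hXi (hYi.const_mul _), ← integral_const_mul, ← Real.norm_eq_abs]
    exact norm_integral_le_of_norm_le (hφi.const_mul _) (ae_of_all _ fun x => weight_aux (hφnn x) ht (hC x t))
  have hD : heatDissipation (torusTopEigMoment q) v = -Y := by
    rw [hY]; exact heatDissipation_topEigMoment_eq_integral hq hv hdv
  have hAeq : slopeIntegral q v t = -(X + frameIntegral q v t) / t ^ 2 := by
    rw [eq_div_iff ht2.ne']
    linarith [hsplit.symm.trans hibp]
  have e : -(X + frameIntegral q v t) / t ^ 2 + frameIntegral q v t / t ^ 2 - -Y = (t ^ 2 * Y - X) / t ^ 2 := by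
    field_simp
    ring
  rw [hD, hAeq, e, abs_div, abs_of_pos ht2, div_le_iff₀ ht2, abs_sub_comm]
  calc |X - t ^ 2 * Y| ≤ C * t ^ 3 * ∫ x, q * L x ^ (q - 1) := hXY
    _ = C * (∫ x, q * L x ^ (q - 1)) * t * t ^ 2 := by ring

/-- **THE DISCRETE FRAME FLOOR, both directions:** `A_t + t⁻² F_t ≤ heatDissipation Φ_q v + C·t` (the treeʼs
one-sided discrete floor sharpened by the non-negative frame term) AND `heatDissipation Φ_q v ≤ A_t + t⁻² F_t + C·t`
(new: an eigenvector-free UPPER bound on the heat price by grid quantities); every real `q ≥ 1`, `t > 0`. [ours] -/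
theorem exists_slope_add_frame_two_sided (hq : 1 ≤ q) (hv : Torus.IsSmooth v) (hdv : Torus.IsDivFree v) :
    ∃ C : ℝ, ∀ t : ℝ, 0 < t →
      slopeIntegral q v t + frameIntegral q v t / t ^ 2 ≤ heatDissipation (torusTopEigMoment q) v + C * t ∧
      heatDissipation (torusTopEigMoment q) v ≤ slopeIntegral q v t + frameIntegral q v t / t ^ 2 + C * t := by
  obtain ⟨C, hC⟩ := exists_abs_slope_add_frame_sub_heat_le hq hv hdv
  exact ⟨C, fun t ht => ⟨by linarith [(abs_le.1 (hC t ht)).2], by linarith [(abs_le.1 (hC t ht)).1]⟩⟩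

/-! ## § 5 The frame cost as a limit (every real `q ≥ 2`, every dimension) -/

/-- The amplitude integral `AF(v) := Σᵢ ∫ q(q−1) λ^{q−2} (∂ᵢλ)²` (junk-valued partials; the treeʼs amplitude-floor
integrand, axis by axis). [ours, bookkeeping] -/
def amplitudeIntegral (q : ℝ) (v : UnitAddTorus d → EuclideanSpace ℝ d) : ℝ :=
  ∑ i, ∫ x, q * (q - 1) * torusStrainTopEig v x ^ (q - 2) * Torus.partialDeriv i (torusStrainTopEig v) x ^ 2

/-- THE FRAME COST of the `Φ_q` heat price: `frameCost q v := heatDissipation Φ_q v − AF(v)`. [ours, bookkeeping] -/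
def frameCost (q : ℝ) (v : UnitAddTorus d → EuclideanSpace ℝ d) : ℝ :=
  heatDissipation (torusTopEigMoment q) v - amplitudeIntegral q v

/-- `A_t → AF(v)` as `t → 0⁺` for `q ≥ 2` (the treeʼs dominated limit, summed over the axes). [ours, bookkeeping] -/
theorem tendsto_slopeIntegral (hq : 2 ≤ q) (hv : Torus.IsSmooth v) (hdv : Torus.IsDivFree v) :
    Tendsto (slopeIntegral q v) (𝓝[>] 0) (𝓝 (amplitudeIntegral q v)) := by
  unfold slopeIntegral amplitudeIntegral
  exact tendsto_finsetSum _ fun i _ => (tendsto_integral_slope_mul_slope hq hv hdv i).2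

/-- **THE FRAME COST IS A LIMIT OF NON-NEGATIVE GRID QUANTITIES:** for smooth divergence-free `v` and real `q ≥ 2`,
`t⁻² ∫ qλ^{q−1} FD_t → frameCost q v` as `t → 0⁺`. [ours] -/
theorem tendsto_frameIntegral_div_sq (hq : 2 ≤ q) (hv : Torus.IsSmooth v) (hdv : Torus.IsDivFree v) :
    Tendsto (fun t : ℝ => frameIntegral q v t / t ^ 2) (𝓝[>] 0) (𝓝 (frameCost q v)) := by
  have hq1 : (1 : ℝ) ≤ q := by linarith
  obtain ⟨C, hC⟩ := exists_abs_slope_add_frame_sub_heat_le hq1 hv hdv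
  have hA := tendsto_slopeIntegral hq hv hdv
  have hR : Tendsto (fun t => slopeIntegral q v t + frameIntegral q v t / t ^ 2 -
      heatDissipation (torusTopEigMoment q) v) (𝓝[>] 0) (𝓝 0) := by
    refine squeeze_zero_norm' (a := fun t => C * t) ?_ ?_
    · filter_upwards [self_mem_nhdsWithin] with t ht using (Real.norm_eq_abs _).trans_le (hC t ht)
    · have h : Tendsto (fun t : ℝ => C * t) (𝓝 (0 : ℝ)) (𝓝 (C * 0)) := tendsto_const_nhds.mul tendsto_id
      rw [mul_zero] at h
      exact h.mono_left nhdsWithin_le_nhds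
  convert (hR.sub hA).add_const (heatDissipation (torusTopEigMoment q) v) using 2 with t
  · ring
  · unfold frameCost; ring

/-- **THE FRAME COST IS NON-NEGATIVE** (`q ≥ 2`, every dimension `d`): the amplitude floor with its deficit
identified. [ours] -/
theorem frameCost_nonneg (hq : 2 ≤ q) (hv : Torus.IsSmooth v) (hdv : Torus.IsDivFree v) : 0 ≤ frameCost q v :=
  ge_of_tendsto (tendsto_frameIntegral_div_sq hq hv hdv) (Filter.Eventually.of_forall fun t =>
    div_nonneg (frameIntegral_nonneg (zero_le_two.trans hq) hv hdv t) (sq_nonneg t))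

/-- By-product: the amplitude floor `AF(v) ≤ heatDissipation Φ_q v` in EVERY dimension (`q ≥ 2`; the treeʼs node
states it for `d = 3`). [ours] -/
theorem amplitudeIntegral_le_heatDissipation (hq : 2 ≤ q) (hv : Torus.IsSmooth v) (hdv : Torus.IsDivFree v) :
    amplitudeIntegral q v ≤ heatDissipation (torusTopEigMoment q) v := by
  have h := frameCost_nonneg hq hv hdv; unfold frameCost at h; linarith

/-! ## § 6 The kill rule (bookkeeping for door (e)) -/

/-- `AF(v) ≥ 0` for fields with `λ₁ ∘ S ≥ 0` and `q ≥ 1`. [ours, bookkeeping] -/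
theorem amplitudeIntegral_nonneg (hq : 1 ≤ q) (hv : Torus.IsSmooth v) (hdv : Torus.IsDivFree v) :
    0 ≤ amplitudeIntegral q v := by
  unfold amplitudeIntegral
  refine Finset.sum_nonneg fun i _ => integral_nonneg fun x =>
    mul_nonneg (mul_nonneg (mul_nonneg (by linarith) (by linarith)) (Real.rpow_nonneg ?_ _)) (sq_nonneg _)
  rw [← lam_strainFlat]
  exact lam_strainFlat_nonneg hv hdv x

/-- **KILL RULE.** If a smooth divergence-free field has heat price `≤ c·Φ_q(v)` (`q ≥ 2`), then BOTH its amplitude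
integral AND its frame cost are `≤ c·Φ_q(v)`: a killing family for L-λ(q) must make the amplitude floor and the
frame cost `o(Φ_q)` separately. No node is decided. [ours] -/
theorem amplitude_le_and_frameCost_le_of_heat_le (hq : 2 ≤ q) (hv : Torus.IsSmooth v) (hdv : Torus.IsDivFree v)
    {c : ℝ} (hc : heatDissipation (torusTopEigMoment q) v ≤ c * torusTopEigMoment q v) :
    amplitudeIntegral q v ≤ c * torusTopEigMoment q v ∧ frameCost q v ≤ c * torusTopEigMoment q v := by
  have h1 := frameCost_nonneg hq hv hdv
  have h2 := amplitudeIntegral_nonneg (one_le_two.trans hq) hv hdv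
  unfold frameCost at h1 ⊢
  constructor <;> linarith

end FrameFloor

end TopEig

end Summit.NavierStokesRegularity.FunctionalMining

end
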